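import Summits.NavierStokesRegularity.NavierStokesRegularity.Theses.SlicedKelvin
import HarnessLib.Audit

/-!
# Skeleton of the piece `SlicedKelvin.SlabApexBound` (child of crux `PlanarFluxAPriori`,
# stmt-NavierStokesRegularity-15600) — line `local-far`

(crux-strategist re-exam r1, `planner-cstrat-stmt-NavierStokesRegularity-15600-r1-0`, 2026-08-17.)

THE PIECE. `SlabApexBound` (= registered stub `stub_slabApexBound` of the live line `Sketch` of the parent crux,
card `halfspace-apex-identity`, transfer target C⁺ in positive-time form): along every classical Leray–Hopf solution
on `[0,T)` from a rapidly decaying datum and for every `t₀ ∈ (0,T)` there are `M` and a slab half-width `h > 0`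
such that the regularised Γ-weighted APEX MEASURE of every slab,
`liminf_{ε→0⁺} ∫_{|⟪x,Re₂⟫−c|<h} (ε²/√(f²+ε²)³)·|Df[curl u(t)]| dx`, `f = ⟪curl u(t), Re₂⟫`
(`→ 2∫_{Z∩slab}|ω·N| dH²` on generic slices: the circulation-weighted number of turning points of the height
`⟪x,Re₂⟫` along vortex lines inside the slab), is `≤ M` for all `t ∈ [t₀,T)`, frames `R`, heights `c`.

THE CUT (the lead's two honest sub-cruxes, `Lines/Sketch.md` §5, typed): split the slab at a radius `ρ`.
* `stub_apexFarFieldTameness` [L/XL, OPEN, plausibly provable independently of blow-up]: beyond SOME radius `ρ`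
  (chosen per solution and `t₀`) the apex density of every slab is bounded for EVERY `ε > 0`, uniformly on
  `[t₀,T)`, frames and heights — far-field regularity up to and including `T` (CKN at infinity: the singular set at a
  first blow-up time is bounded) + analyticity in `x` at positive times + decay: the `|curl u|`-weighted area of the
  level sets `{⟪curl u(t), n⟫ = λ} ∩ {|x| ≥ ρ}` is tame. Not in print (Sketch.md §3 "far field … plausible, NOT proved").
* `stub_apexLocalBound` [XL, OPEN — the content]: inside EVERY ball `B_ρ` the `liminf_{ε→0⁺}` apex measure of
  slabs of some width `h(ρ)` is bounded uniformly on `[t₀,T)`, frames and heights — LEVEL-ZERO REGULARITY of the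
  Gelfand–Leray function of `⟪curl u, n⟫` in balls up to the (possible) blow-up time: this is where a singularity
  forming at `T` is faced (attack: Ertel births-only law — transport and sliding cancel identically in `dτ_ε/dt`,
  births live on the codimension-2 inflection locus `{f = 0, (ω·∇)f = 0}` with density `|(Sω)_n|` — plus
  Constantin 1990 §3–4 level-set calculus; calibration lemmas of the lead: `stub_apexBudgetTimeIntegrated` p161154).
NEGATIVE KNOWLEDGE HONOURED: `Theorems.PlanarFluxAPriori.Negative.slabApexBound_false_kinematic` / `_false_forData`
(the functional is `+∞` on a smooth compactly supported divergence-free apex foam — so neither stub is kinematic: both are along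
the NS solution at times `≥ t₀ > 0`) and `slabApexBound_false_from_initialTime` (`t₀ = 0` is false — both stubs take
`t₀ ∈ Ioo 0 T`).
COMPOSITION `slabApexBound_of_stubs` (closed, pure measure/filter bookkeeping: `h := min h₁ h₂`, `M := M₁ + M₂`,
`∫_{S} = ∫_{S∩B_ρ} + ∫_{S∖B_ρ}`, `liminf_ε (A_ε + M₂) = liminf_ε A_ε + M₂`).
-/

noncomputable section

namespace Summit.NavierStokesRegularity.NavierStokesRegularity.Cruxes.SlabApexBound.LocalFar

set_option linter.unusedVariables false
set_option linter.dupNamespace false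

open MeasureTheory Set Filter Literature.Analysis.FluidPDE
open scoped ENNReal NNReal Topology

/-- **stub 1 — `stub_apexLocalBound` [XL, OPEN: level-zero regularity of `⟪curl u, n⟫` in balls, up to `T`].**
For every radius `ρ > 0` there are `M` and `h > 0` such that the `liminf_{ε→0⁺}` regularised apex measure of
`{|⟪x,Re₂⟫ − c| < h} ∩ B_ρ(0)` is `≤ M` for all `t ∈ [t₀,T)`, frames `R`, heights `c`. -/
theorem stub_apexLocalBound :
    ∀ (ν T : ℝ), 0 < ν → 0 < T → ∀ (u : ℝ → EuclideanSpace ℝ (Fin 3) → EuclideanSpace ℝ (Fin 3))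
      (p : ℝ → EuclideanSpace ℝ (Fin 3) → ℝ),
      Literature.Analysis.FluidPDE.IsClassicalNSSolutionOn (Set.Ico 0 T) ν 0 u p →
      Literature.Analysis.FluidPDE.IsLerayHopfOn T ν 0 (u 0) u →
      Literature.Analysis.FluidPDE.HasRapidSpatialDecay (u 0) →
      ∀ t₀ ∈ Set.Ioo 0 T, ∀ (ρ : ℝ), 0 < ρ → ∃ M : NNReal, ∃ h : ℝ, 0 < h ∧ ∀ t ∈ Set.Ico t₀ T,
        ∀ (R : EuclideanSpace ℝ (Fin 3) ≃ₗᵢ[ℝ] EuclideanSpace ℝ (Fin 3)) (c : ℝ),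
        Filter.liminf (fun ε : ℝ => ∫⁻ x in {x : EuclideanSpace ℝ (Fin 3) |
            |inner ℝ x (R (EuclideanSpace.single 2 1)) - c| < h} ∩ Metric.ball 0 ρ,
          ENNReal.ofReal (ε ^ 2 / Real.sqrt (inner ℝ (Literature.Analysis.FluidPDE.curl (u t) x)
            (R (EuclideanSpace.single 2 1)) ^ 2 + ε ^ 2) ^ 3 *
            |fderiv ℝ (fun z => inner ℝ (Literature.Analysis.FluidPDE.curl (u t) z) (R (EuclideanSpace.single 2 1)))
              x (Literature.Analysis.FluidPDE.curl (u t) x)|)) (nhdsWithin 0 (Set.Ioi 0)) ≤ (M : ENNReal) := by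
  sorry

/-- **stub 2 — `stub_apexFarFieldTameness` [L/XL, OPEN: far-field tameness of the `|curl u|`-weighted level sets
of `⟪curl u, n⟫`, up to and including `T`].** There is a radius `ρ > 0` and there are `M`, `h > 0` such that for
EVERY `ε > 0` the regularised apex measure of `{|⟪x,Re₂⟫ − c| < h} ∖ B_ρ(0)` is `≤ M`, for all `t ∈ [t₀,T)`,
frames `R`, heights `c`. -/
theorem stub_apexFarFieldTameness :
    ∀ (ν T : ℝ), 0 < ν → 0 < T → ∀ (u : ℝ → EuclideanSpace ℝ (Fin 3) → EuclideanSpace ℝ (Fin 3))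
      (p : ℝ → EuclideanSpace ℝ (Fin 3) → ℝ),
      Literature.Analysis.FluidPDE.IsClassicalNSSolutionOn (Set.Ico 0 T) ν 0 u p →
      Literature.Analysis.FluidPDE.IsLerayHopfOn T ν 0 (u 0) u →
      Literature.Analysis.FluidPDE.HasRapidSpatialDecay (u 0) →
      ∀ t₀ ∈ Set.Ioo 0 T, ∃ ρ : ℝ, 0 < ρ ∧ ∃ M : NNReal, ∃ h : ℝ, 0 < h ∧ ∀ t ∈ Set.Ico t₀ T,
        ∀ (R : EuclideanSpace ℝ (Fin 3) ≃ₗᵢ[ℝ] EuclideanSpace ℝ (Fin 3)) (c : ℝ) (ε : ℝ), 0 < ε →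
        ∫⁻ x in {x : EuclideanSpace ℝ (Fin 3) |
            |inner ℝ x (R (EuclideanSpace.single 2 1)) - c| < h} \ Metric.ball 0 ρ,
          ENNReal.ofReal (ε ^ 2 / Real.sqrt (inner ℝ (Literature.Analysis.FluidPDE.curl (u t) x)
            (R (EuclideanSpace.single 2 1)) ^ 2 + ε ^ 2) ^ 3 *
            |fderiv ℝ (fun z => inner ℝ (Literature.Analysis.FluidPDE.curl (u t) z) (R (EuclideanSpace.single 2 1)))
              x (Literature.Analysis.FluidPDE.curl (u t) x)|) ≤ (M : ENNReal) := by
  sorry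

/-- **Composition, closed form.** The two stub STATEMENTS (as hypotheses) imply the piece (conclusion = the
body of `Theses.SlicedKelvin.SlabApexBound`, verbatim): `h := min h₁ h₂`, `M := M₁ + M₂`, the slab integral
splits at `B_ρ`, the far part is `≤ M₂` for every `ε > 0`, and `liminf_ε (A_ε + M₂) = liminf_ε A_ε + M₂`. -/
theorem slabApexBound_of_stubs
    (hloc : ∀ (ν T : ℝ), 0 < ν → 0 < T → ∀ (u : ℝ → EuclideanSpace ℝ (Fin 3) → EuclideanSpace ℝ (Fin 3))
      (p : ℝ → EuclideanSpace ℝ (Fin 3) → ℝ),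
      Literature.Analysis.FluidPDE.IsClassicalNSSolutionOn (Set.Ico 0 T) ν 0 u p →
      Literature.Analysis.FluidPDE.IsLerayHopfOn T ν 0 (u 0) u →
      Literature.Analysis.FluidPDE.HasRapidSpatialDecay (u 0) →
      ∀ t₀ ∈ Set.Ioo 0 T, ∀ (ρ : ℝ), 0 < ρ → ∃ M : NNReal, ∃ h : ℝ, 0 < h ∧ ∀ t ∈ Set.Ico t₀ T,
        ∀ (R : EuclideanSpace ℝ (Fin 3) ≃ₗᵢ[ℝ] EuclideanSpace ℝ (Fin 3)) (c : ℝ),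
        Filter.liminf (fun ε : ℝ => ∫⁻ x in {x : EuclideanSpace ℝ (Fin 3) |
            |inner ℝ x (R (EuclideanSpace.single 2 1)) - c| < h} ∩ Metric.ball 0 ρ,
          ENNReal.ofReal (ε ^ 2 / Real.sqrt (inner ℝ (Literature.Analysis.FluidPDE.curl (u t) x)
            (R (EuclideanSpace.single 2 1)) ^ 2 + ε ^ 2) ^ 3 *
            |fderiv ℝ (fun z => inner ℝ (Literature.Analysis.FluidPDE.curl (u t) z) (R (EuclideanSpace.single 2 1)))
              x (Literature.Analysis.FluidPDE.curl (u t) x)|)) (nhdsWithin 0 (Set.Ioi 0)) ≤ (M : ENNReal))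
    (hfar : ∀ (ν T : ℝ), 0 < ν → 0 < T → ∀ (u : ℝ → EuclideanSpace ℝ (Fin 3) → EuclideanSpace ℝ (Fin 3))
      (p : ℝ → EuclideanSpace ℝ (Fin 3) → ℝ),
      Literature.Analysis.FluidPDE.IsClassicalNSSolutionOn (Set.Ico 0 T) ν 0 u p →
      Literature.Analysis.FluidPDE.IsLerayHopfOn T ν 0 (u 0) u →
      Literature.Analysis.FluidPDE.HasRapidSpatialDecay (u 0) →
      ∀ t₀ ∈ Set.Ioo 0 T, ∃ ρ : ℝ, 0 < ρ ∧ ∃ M : NNReal, ∃ h : ℝ, 0 < h ∧ ∀ t ∈ Set.Ico t₀ T,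
        ∀ (R : EuclideanSpace ℝ (Fin 3) ≃ₗᵢ[ℝ] EuclideanSpace ℝ (Fin 3)) (c : ℝ) (ε : ℝ), 0 < ε →
        ∫⁻ x in {x : EuclideanSpace ℝ (Fin 3) |
            |inner ℝ x (R (EuclideanSpace.single 2 1)) - c| < h} \ Metric.ball 0 ρ,
          ENNReal.ofReal (ε ^ 2 / Real.sqrt (inner ℝ (Literature.Analysis.FluidPDE.curl (u t) x)
            (R (EuclideanSpace.single 2 1)) ^ 2 + ε ^ 2) ^ 3 *
            |fderiv ℝ (fun z => inner ℝ (Literature.Analysis.FluidPDE.curl (u t) z) (R (EuclideanSpace.single 2 1)))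
              x (Literature.Analysis.FluidPDE.curl (u t) x)|) ≤ (M : ENNReal)) :
    ∀ (ν T : ℝ), 0 < ν → 0 < T → ∀ (u : ℝ → EuclideanSpace ℝ (Fin 3) → EuclideanSpace ℝ (Fin 3))
      (p : ℝ → EuclideanSpace ℝ (Fin 3) → ℝ),
      Literature.Analysis.FluidPDE.IsClassicalNSSolutionOn (Set.Ico 0 T) ν 0 u p →
      Literature.Analysis.FluidPDE.IsLerayHopfOn T ν 0 (u 0) u →
      Literature.Analysis.FluidPDE.HasRapidSpatialDecay (u 0) →
      ∀ t₀ ∈ Set.Ioo 0 T, ∃ M : NNReal, ∃ h : ℝ, 0 < h ∧ ∀ t ∈ Set.Ico t₀ T,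
        ∀ (R : EuclideanSpace ℝ (Fin 3) ≃ₗᵢ[ℝ] EuclideanSpace ℝ (Fin 3)) (c : ℝ),
        Filter.liminf (fun ε : ℝ => ∫⁻ x in {x : EuclideanSpace ℝ (Fin 3) |
            |inner ℝ x (R (EuclideanSpace.single 2 1)) - c| < h},
          ENNReal.ofReal (ε ^ 2 / Real.sqrt (inner ℝ (Literature.Analysis.FluidPDE.curl (u t) x)
            (R (EuclideanSpace.single 2 1)) ^ 2 + ε ^ 2) ^ 3 *
            |fderiv ℝ (fun z => inner ℝ (Literature.Analysis.FluidPDE.curl (u t) z) (R (EuclideanSpace.single 2 1)))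
              x (Literature.Analysis.FluidPDE.curl (u t) x)|)) (nhdsWithin 0 (Set.Ioi 0)) ≤ (M : ENNReal) := by
  intro ν T hν hT u p hcl hLH hdec t₀ ht₀
  obtain ⟨ρ, hρ, M₂, h₂, hh₂, hfarb⟩ := hfar ν T hν hT u p hcl hLH hdec t₀ ht₀
  obtain ⟨M₁, h₁, hh₁, hlocb⟩ := hloc ν T hν hT u p hcl hLH hdec t₀ ht₀ ρ hρ
  refine ⟨M₁ + M₂, min h₁ h₂, lt_min hh₁ hh₂, fun t ht R c => ?_⟩
  -- the regularised apex density of the slice `u t` in the frame `R`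
  set d : ℝ → EuclideanSpace ℝ (Fin 3) → ℝ≥0∞ := fun ε x =>
    ENNReal.ofReal (ε ^ 2 / Real.sqrt (inner ℝ (Literature.Analysis.FluidPDE.curl (u t) x)
      (R (EuclideanSpace.single 2 1)) ^ 2 + ε ^ 2) ^ 3 *
      |fderiv ℝ (fun z => inner ℝ (Literature.Analysis.FluidPDE.curl (u t) z) (R (EuclideanSpace.single 2 1)))
        x (Literature.Analysis.FluidPDE.curl (u t) x)|) with hd
  -- slabs
  set S : ℝ → Set (EuclideanSpace ℝ (Fin 3)) := fun h =>
    {x : EuclideanSpace ℝ (Fin 3) | |inner ℝ x (R (EuclideanSpace.single 2 1)) - c| < h} with hS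
  have hS1 : S (min h₁ h₂) ⊆ S h₁ :=
    fun x (hx : |inner ℝ x (R (EuclideanSpace.single 2 1)) - c| < min h₁ h₂) =>
      show |inner ℝ x (R (EuclideanSpace.single 2 1)) - c| < h₁ from lt_of_lt_of_le hx (min_le_left _ _)
  have hS2 : S (min h₁ h₂) ⊆ S h₂ :=
    fun x (hx : |inner ℝ x (R (EuclideanSpace.single 2 1)) - c| < min h₁ h₂) =>
      show |inner ℝ x (R (EuclideanSpace.single 2 1)) - c| < h₂ from lt_of_lt_of_le hx (min_le_right _ _)
  -- split the slab integral at the ball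
  have hsplit : ∀ ε : ℝ, ∫⁻ x in S (min h₁ h₂), d ε x =
      (∫⁻ x in S (min h₁ h₂) ∩ Metric.ball 0 ρ, d ε x) + ∫⁻ x in S (min h₁ h₂) \ Metric.ball 0 ρ, d ε x :=
    fun ε => (lintegral_inter_add_sdiff (d ε) (S (min h₁ h₂)) Metric.isOpen_ball.measurableSet).symm
  have hmono1 : ∀ ε : ℝ, (∫⁻ x in S (min h₁ h₂) ∩ Metric.ball 0 ρ, d ε x) ≤
      ∫⁻ x in S h₁ ∩ Metric.ball 0 ρ, d ε x :=
    fun ε => lintegral_mono_set (inter_subset_inter_left _ hS1)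
  have hmono2 : ∀ ε : ℝ, 0 < ε → (∫⁻ x in S (min h₁ h₂) \ Metric.ball 0 ρ, d ε x) ≤ (M₂ : ℝ≥0∞) :=
    fun ε hε => (lintegral_mono_set (Set.sdiff_subset_sdiff_left hS2)).trans (hfarb t ht R c ε hε)
  have hev : ∀ᶠ ε in nhdsWithin (0 : ℝ) (Set.Ioi 0), (∫⁻ x in S (min h₁ h₂), d ε x) ≤
      (fun ε => ∫⁻ x in S h₁ ∩ Metric.ball 0 ρ, d ε x) ε + (M₂ : ℝ≥0∞) := by
    filter_upwards [self_mem_nhdsWithin] with ε hε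
    rw [hsplit ε]
    exact add_le_add (hmono1 ε) (hmono2 ε hε)
  calc Filter.liminf (fun ε : ℝ => ∫⁻ x in S (min h₁ h₂), d ε x) (nhdsWithin 0 (Set.Ioi 0))
      ≤ Filter.liminf (fun ε : ℝ => (fun ε => ∫⁻ x in S h₁ ∩ Metric.ball 0 ρ, d ε x) ε + (M₂ : ℝ≥0∞))
          (nhdsWithin 0 (Set.Ioi 0)) := Filter.liminf_le_liminf hev
    _ = Filter.liminf (fun ε : ℝ => ∫⁻ x in S h₁ ∩ Metric.ball 0 ρ, d ε x) (nhdsWithin 0 (Set.Ioi 0)) +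
          (M₂ : ℝ≥0∞) :=
        liminf_add_const (nhdsWithin (0 : ℝ) (Set.Ioi 0)) _ _ (by isBoundedDefault) (by isBoundedDefault)
    _ ≤ (M₁ : ℝ≥0∞) + (M₂ : ℝ≥0∞) := add_le_add (hlocb t ht R c) le_rfl
    _ = ((M₁ + M₂ : NNReal) : ℝ≥0∞) := (ENNReal.coe_add M₁ M₂).symm

/-- **The skeleton (A12 by-name form).** The piece BY NAME — the route decl
`Theses.SlicedKelvin.SlabApexBound` (item stmt-NavierStokesRegularity-18181, route rev 6) — modulo the two registered
stubs. -/
theorem SlabApexBound_of : _root_.Summit.NavierStokesRegularity.NavierStokesRegularity.Theses.SlicedKelvin.SlabApexBound :=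
  slabApexBound_of_stubs stub_apexLocalBound stub_apexFarFieldTameness

end Summit.NavierStokesRegularity.NavierStokesRegularity.Cruxes.SlabApexBound.LocalFar

end
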